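import Literature.Geometry.Riemannian.NoLocalCollapsingDoubling
import Literature.Geometry.Riemannian.KernelNashEntropyUniversalBound
import Literature.Geometry.Riemannian.KernelNashEntropyMonotone
import Literature.Geometry.Riemannian.SmallBallVolume
import HarnessLib

/-!
# Bamler's no-local-collapsing theorem with the pointed Nash entropy (Bamler 2020a, Thm. 6.1)

R. Bamler, *Entropy and heat kernel bounds on a Ricci flow background*, arXiv:2008.07093 (2020a),
§6.1 Thm. 6.1 (arXiv v1 Thm. 22): for a Ricci flow of a smooth family of Riemannian metrics on a
closed connected `m`-manifold, `m ≥ 3`, times `a < s < t < T` with `R ≥ R_min` on `M × [s,t]`,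
`−R_min(t − s) ≤ Λ`, and a point `x` with `R_t ≤ 1/(t−s)` on the ball `B_t(x, √(t−s))`,

  `Vol_t B_t(x, √(t−s)) ≥ c(m, Λ) (t−s)^{m/2} exp(𝒩*_s(x, t))`

(`exists_riemVolume_ball_ge_exp_pointedNashEntropy`). Proof (§6.2 of the source): the reduction
to the doubling case `Vol B_r ≤ 3^m Vol B_{r/2}` (`exists_riemVolume_ball_ge_of_doubling`,
`NoLocalCollapsingDoubling.lean`) by descent over the scales `r, r/2, r/4, …`; the source closes
the descent with `lim_{r→0} 𝒩_{x,t}(r²) = 0` (kernel asymptotics), here the universal bound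
`𝒩* ≤ (m/2) log(H_m/(2m))` (`kernelNashEntropy_le_universal`) and the universal
small-scale volume bound `Vol B_ρ ≥ c_u ρ^m` (`exists_riemVolume_ball_ge_small`) serve instead.
Everything is proved; no definitions, no named facts.

## References

* R. H. Bamler, *Entropy and heat kernel bounds on a Ricci flow background*, arXiv:2008.07093
  (2020), §6.1 Thm. 6.1, §6.2 (proof). [Bamler2020Entropy]
-/

noncomputable section

open Set Filter Function MeasureTheory Measure Module
open scoped Manifold ContDiff Topology ENNReal NNReal

namespace Literature.Geometry.Riemannian

open Lorentzian Lorentzian.PseudoRiemannianMetric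

set_option maxHeartbeats 1600000 in
/-- **Bamler 2020a, Thm. 6.1 (arXiv v1 Thm. 22): no local collapsing with the pointed Nash
entropy.** For `m ≥ 3` and `Λ ≥ 0` there is `c > 0` such that for every Ricci flow on `[a, T]`
of a smooth family of Riemannian metrics on a closed connected manifold modelled on `ℝᵐ`, all
`a < s < t < T` with `R ≥ R_min` on `M × [s,t]` and `−R_min (t−s) ≤ Λ`, and every `x` with
`R_t ≤ 1/(t−s)` on `B_t(x, √(t−s))`:
`c (t−s)^{m/2} exp(𝒩*_s(x,t)) ≤ Vol_t B_t(x, √(t−s))`. Descent over dyadic scales from the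
doubling case, closed by the universal entropy bound and the universal small-ball volume bound.
[cite: Bamler2020Entropy, §6.1 Thm. 6.1; §6.2] -/
theorem exists_riemVolume_ball_ge_exp_pointedNashEntropy (m : ℕ) (hm : 3 ≤ m) {Λ : ℝ}
    (hΛ : 0 ≤ Λ) :
    ∃ c : ℝ, 0 < c ∧ ∀ {M : Type*} [TopologicalSpace M]
      [ChartedSpace (EuclideanSpace ℝ (Fin m)) M]
      [IsManifold 𝓘(ℝ, EuclideanSpace ℝ (Fin m)) ∞ M] [T2Space M] [CompactSpace M]
      [SecondCountableTopology M] [MeasurableSpace M] [BorelSpace M] [ConnectedSpace M] [T3Space M]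
      {h : ℝ → PseudoRiemannianMetric 𝓘(ℝ, EuclideanSpace ℝ (Fin m)) ∞ (EuclideanSpace ℝ (Fin m))
        (TangentSpace 𝓘(ℝ, EuclideanSpace ℝ (Fin m)) : M → Type _)}
      {cov : ℝ → CovariantDerivative 𝓘(ℝ, EuclideanSpace ℝ (Fin m)) (EuclideanSpace ℝ (Fin m))
        (TangentSpace 𝓘(ℝ, EuclideanSpace ℝ (Fin m)) : M → Type _)}
      {a T : ℝ} (hflow : IsRicciFlow h cov (Icc a T)) (hh : IsContMDiffFamilyOn ∞ h univ)
      (hR : ∀ r, (h r).IsRiemannian),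
      ∀ {s t : ℝ}, a < s → s < t → t < T → ∀ {Rmin : ℝ},
      (∀ r ∈ Icc s t, ∀ z : M, Rmin ≤ (h r).scalarCurvatureWith (cov r) z) →
      -Rmin * (t - s) ≤ Λ → ∀ x : M,
      (∀ y : M, (h t).edist (hR t) x y < ENNReal.ofReal (Real.sqrt (t - s)) →
        (h t).scalarCurvatureWith (cov t) y ≤ 1 / (t - s)) →
      c * (t - s) ^ ((m : ℝ) / 2) *
          Real.exp (pointedNashEntropy h (fun r v ↦ hflow.heatKernelFn hh hR t x (v, r)) m t s) ≤
        (h t).riemVolume.real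
          {y | (h t).edist (hR t) x y < ENNReal.ofReal (Real.sqrt (t - s))} := by
  classical
  -- universal constants: doubling case, small balls, entropy
  obtain ⟨c₁, hc₁, H1⟩ := exists_riemVolume_ball_ge_of_doubling m hm hΛ
  obtain ⟨cu, hcu, HU⟩ := exists_riemVolume_ball_ge_small m (H := EuclideanSpace ℝ (Fin m))
    (I := 𝓘(ℝ, EuclideanSpace ℝ (Fin m)))
  set cm : ℝ := (m : ℝ) / 2 * Real.log ((((m : ℝ) - 1) * Real.pi ^ 2 / 2 + 4) / (2 * m)) with hcm
  set c : ℝ := min c₁ (cu * Real.exp (-cm) / 2) with hc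
  have hc0 : 0 < c := lt_min hc₁ (by positivity)
  have hcc₁ : c ≤ c₁ := min_le_left _ _
  have hccu : c * Real.exp cm ≤ cu / 2 := by
    have : c ≤ cu * Real.exp (-cm) / 2 := min_le_right _ _
    calc c * Real.exp cm ≤ cu * Real.exp (-cm) / 2 * Real.exp cm :=
          mul_le_mul_of_nonneg_right this (Real.exp_pos _).le
      _ = cu / 2 := by rw [Real.exp_neg]; field_simp
  refine ⟨c, hc0, ?_⟩
  intro M _ _ _ _ _ _ _ _ _ _ h cov a T hflow hh hR s t has hst htT Rmin hRmin hRΛ x hRup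
  have hm0 : 0 < m := by omega
  -- notation at scale `ρ`: the ball, its volume, the entropy at `s' = t − ρ²`
  set vol : ℝ → ℝ := fun ρ ↦ (h t).riemVolume.real
    {y | (h t).edist (hR t) x y < ENNReal.ofReal ρ} with hvol
  set N : ℝ → ℝ := fun ρ ↦
    pointedNashEntropy h (fun r v ↦ hflow.heatKernelFn hh hR t x (v, r)) m t (t - ρ ^ 2) with hN
  set r : ℝ := Real.sqrt (t - s) with hr
  have hτ : 0 < t - s := sub_pos.2 hst
  have hr0 : 0 < r := Real.sqrt_pos.2 hτ
  have hr2 : r ^ 2 = t - s := Real.sq_sqrt hτ.le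
  have hvol_mono : ∀ {ρ₁ ρ₂ : ℝ}, ρ₁ ≤ ρ₂ → vol ρ₁ ≤ vol ρ₂ := by
    intro ρ₁ ρ₂ h12
    haveI : IsFiniteMeasure (h t).riemVolume := ⟨(h t).riemVolume_univ_lt_top⟩
    exact measureReal_mono (fun y (hy : _ < _) ↦ lt_of_lt_of_le hy (ENNReal.ofReal_le_ofReal h12))
      (measure_ne_top _ _)
  /- the doubling case at any dyadic scale `ρ ≤ r`: if `vol ρ ≤ 3^m vol (ρ/2)` then the bound holds
     at scale `ρ` with constant `c₁` -/
  have hscale : ∀ {ρ : ℝ}, 0 < ρ → ρ ≤ r → vol ρ ≤ 3 ^ m * vol (ρ / 2) →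
      c₁ * ρ ^ m * Real.exp (N ρ) ≤ vol ρ := by
    intro ρ hρ hρr hdoub
    have hρ2 : 0 < ρ ^ 2 := by positivity
    have hρ2le : ρ ^ 2 ≤ t - s := by rw [← hr2]; exact pow_le_pow_left₀ hρ.le hρr 2
    set s' : ℝ := t - ρ ^ 2 with hs'
    have hss' : s ≤ s' := by rw [hs']; linarith
    have has' : a < s' := has.trans_le hss'
    have hs't : s' < t := by rw [hs']; linarith
    have hsqrt : Real.sqrt (t - s') = ρ := by
      rw [hs', sub_sub_cancel, Real.sqrt_sq hρ.le]
    have hRmin' : ∀ r' ∈ Icc s' t, ∀ z : M, Rmin ≤ (h r').scalarCurvatureWith (cov r') z :=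
      fun r' hr' z ↦ hRmin r' ⟨hss'.trans hr'.1, hr'.2⟩ z
    have hRΛ' : -Rmin * (t - s') ≤ Λ := by
      rcases le_total Rmin 0 with hR0 | hR0
      · calc -Rmin * (t - s') ≤ -Rmin * (t - s) :=
            mul_le_mul_of_nonneg_left (by linarith) (neg_nonneg.2 hR0)
          _ ≤ Λ := hRΛ
      · have : -Rmin * (t - s') ≤ 0 :=
          mul_nonpos_of_nonpos_of_nonneg (neg_nonpos.2 hR0) (by linarith)
        linarith
    have hRup' : ∀ y : M, (h t).edist (hR t) x y < ENNReal.ofReal (Real.sqrt (t - s')) →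
        (h t).scalarCurvatureWith (cov t) y ≤ 1 / (t - s') := by
      intro y hy
      rw [hsqrt] at hy
      have hy' : (h t).edist (hR t) x y < ENNReal.ofReal (Real.sqrt (t - s)) :=
        lt_of_lt_of_le hy (by rw [← hr]; exact ENNReal.ofReal_le_ofReal hρr)
      have h1 := hRup y hy'
      have h2 : 1 / (t - s) ≤ 1 / (t - s') := by
        rw [hs', sub_sub_cancel]
        exact one_div_le_one_div_of_le hρ2 hρ2le
      exact h1.trans h2
    have hd' : (h t).riemVolume.real
          {y | (h t).edist (hR t) x y < ENNReal.ofReal (Real.sqrt (t - s'))} ≤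
        3 ^ m * (h t).riemVolume.real
          {y | (h t).edist (hR t) x y < ENNReal.ofReal (Real.sqrt (t - s') / 2)} := by
      rw [hsqrt]; exact hdoub
    have key := H1 hflow hh hR has' hs't htT.le hRmin' hRΛ' x hRup' hd'
    rw [hsqrt] at key
    have e1 : (t - s') ^ ((m : ℝ) / 2) = ρ ^ m := by
      rw [hs', sub_sub_cancel, ← Real.rpow_natCast ρ m, ← Real.rpow_natCast ρ 2,
        ← Real.rpow_mul hρ.le]
      congr 1; push_cast; ring
    rw [e1] at key
    exact key
  /- failure at a scale forces failure at the half scale -/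
  have hfail : ∀ {ρ : ℝ}, 0 < ρ → ρ ≤ r → vol ρ < c * ρ ^ m * Real.exp (N ρ) →
      vol (ρ / 2) < c * (ρ / 2) ^ m * Real.exp (N (ρ / 2)) := by
    intro ρ hρ hρr hlt
    -- doubling must fail
    have hnd : ¬ vol ρ ≤ 3 ^ m * vol (ρ / 2) := by
      intro hdoub
      have h1 := hscale hρ hρr hdoub
      have h2 : c * ρ ^ m * Real.exp (N ρ) ≤ c₁ * ρ ^ m * Real.exp (N ρ) :=
        mul_le_mul_of_nonneg_right (mul_le_mul_of_nonneg_right hcc₁ (by positivity))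
          (Real.exp_pos _).le
      linarith
    rw [not_le] at hnd
    -- the entropy at the earlier time is smaller
    have hρ2 : 0 < ρ ^ 2 := by positivity
    have hρ2le : ρ ^ 2 ≤ t - s := by rw [← hr2]; exact pow_le_pow_left₀ hρ.le hρr 2
    have hNmono : N ρ ≤ N (ρ / 2) := by
      simp only [hN]
      refine kernelNashEntropy_mono hflow hh hR hm (by linarith) ?_ ?_ htT.le x
      · nlinarith
      · have : 0 < (ρ / 2) ^ 2 := by positivity
        linarith
    have h3m : (0 : ℝ) < 3 ^ m := by positivity
    calc vol (ρ / 2) < (3 ^ m)⁻¹ * vol ρ := by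
          rw [lt_inv_mul_iff₀ h3m]; linarith
      _ < (3 ^ m)⁻¹ * (c * ρ ^ m * Real.exp (N ρ)) :=
          mul_lt_mul_of_pos_left hlt (inv_pos.2 h3m)
      _ ≤ c * (ρ / 2) ^ m * Real.exp (N (ρ / 2)) := by
          have e : (3 ^ m : ℝ)⁻¹ * (c * ρ ^ m * Real.exp (N ρ)) =
              (2 / 3) ^ m * (c * (ρ / 2) ^ m) * Real.exp (N ρ) := by
            rw [div_pow, div_pow]; field_simp
          rw [e]
          refine mul_le_mul ?_ (Real.exp_le_exp.2 hNmono) (Real.exp_pos _).le (by positivity)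
          have h23 : ((2 : ℝ) / 3) ^ m ≤ 1 := pow_le_one₀ (by norm_num) (by norm_num)
          have : 0 ≤ c * (ρ / 2) ^ m := by positivity
          nlinarith
  -- by contradiction: failure at `r` propagates to all dyadic scales
  by_contra hcon
  rw [not_le] at hcon
  have hcon' : vol r < c * r ^ m * Real.exp (N r) := by
    have e1 : (t - s) ^ ((m : ℝ) / 2) = r ^ m := by
      rw [← hr2, ← Real.rpow_natCast r m, ← Real.rpow_natCast r 2, ← Real.rpow_mul hr0.le]
      congr 1; push_cast; ring
    have e2 : N r = pointedNashEntropy h (fun r v ↦ hflow.heatKernelFn hh hR t x (v, r)) m t s := by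
      simp only [hN]; rw [hr2, sub_sub_cancel]
    rw [e2, ← e1]; exact hcon
  have hall : ∀ k : ℕ, vol (r / 2 ^ k) < c * (r / 2 ^ k) ^ m * Real.exp (N (r / 2 ^ k)) := by
    intro k
    induction k with
    | zero => simpa using hcon'
    | succ k ih =>
      have hρ : 0 < r / 2 ^ k := by positivity
      have hρr : r / 2 ^ k ≤ r := div_le_self hr0.le (one_le_pow₀ (by norm_num))
      have := hfail hρ hρr ih
      rwa [pow_succ, ← div_div]
  -- the universal entropy bound makes the right side `≤ (cu/2) ρ^m`
  have hNle : ∀ k : ℕ, N (r / 2 ^ k) ≤ cm := by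
    intro k
    simp only [hN]
    have hρ : 0 < r / 2 ^ k := by positivity
    have hρr : r / 2 ^ k ≤ r := div_le_self hr0.le (one_le_pow₀ (by norm_num))
    have hρ2le : (r / 2 ^ k) ^ 2 ≤ t - s := by rw [← hr2]; exact pow_le_pow_left₀ hρ.le hρr 2
    have hρ2 : 0 < (r / 2 ^ k) ^ 2 := by positivity
    exact kernelNashEntropy_le_universal hflow hh hR hm0 (by linarith) (by linarith) htT x
  -- the universal small-ball bound at a small dyadic scale: contradiction
  obtain ⟨ρ₀, hρ₀, hsmall⟩ := HU (h t) (hR t) x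
  obtain ⟨k, hk⟩ := pow_unbounded_of_one_lt (r / ρ₀) (by norm_num : (1 : ℝ) < 2)
  have hρk : r / 2 ^ k ≤ ρ₀ := by
    rw [div_le_iff₀ (by positivity)]
    rw [div_lt_iff₀ hρ₀] at hk
    linarith
  have hρkpos : 0 < r / 2 ^ k := by positivity
  have h1 := hsmall (r / 2 ^ k) ⟨hρkpos, hρk⟩
  have h2 := hall k
  have h3 : c * (r / 2 ^ k) ^ m * Real.exp (N (r / 2 ^ k)) ≤ cu / 2 * (r / 2 ^ k) ^ m := by
    calc c * (r / 2 ^ k) ^ m * Real.exp (N (r / 2 ^ k))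
        ≤ c * (r / 2 ^ k) ^ m * Real.exp cm := by
          refine mul_le_mul_of_nonneg_left (Real.exp_le_exp.2 (hNle k)) (by positivity)
      _ = c * Real.exp cm * (r / 2 ^ k) ^ m := by ring
      _ ≤ cu / 2 * (r / 2 ^ k) ^ m := mul_le_mul_of_nonneg_right hccu (by positivity)
  have h4 : 0 < (r / 2 ^ k) ^ m := by positivity
  have : cu * (r / 2 ^ k) ^ m < cu / 2 * (r / 2 ^ k) ^ m := by
    calc cu * (r / 2 ^ k) ^ m ≤ vol (r / 2 ^ k) := h1
      _ < c * (r / 2 ^ k) ^ m * Real.exp (N (r / 2 ^ k)) := h2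
      _ ≤ cu / 2 * (r / 2 ^ k) ^ m := h3
  nlinarith

end Literature.Geometry.Riemannian

end
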